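import Literature.AlgebraicGeometry.Frobenioids.ArchimedeanAutActionReadings
import Literature.AlgebraicGeometry.Frobenioids.Thm36SubInstancesA
import Literature.AlgebraicGeometry.Frobenioids.Thm36SubProofs
import Literature.AlgebraicGeometry.Frobenioids.ArchimedeanBaseComparison
import Literature.AlgebraicGeometry.Frobenioids.ArchimedeanFrobenioidRelative
import HarnessLib

/-!
# Frobenioids II, Theorem 3.6 (iv), second sentence: the PRINTED-AS-TYPED predicate `Thm36iv_faithful`
# decided at the genuine carriers `C^ℤ = C`, `C^ℚ = C^pf`, `C^ℝ = C^rlf`, `A`, and the two repaired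
# readings re-headed at `C^Λ` for every `Λ` (proof-only)

Mochizuki, *The geometry of Frobenioids II: poly-Frobenioids*, Kyushu J. Math. **62** (2008) 401–460, §3,
Theorem 3.6 (iv), author's kurims text p. 37 l. 18, proof p. 39 l. 12 ("immediate from the definitions")
[cite: MochizukiFrdII2008, Thm 3.6 (iv) p.37]:

> "(iv) Let `A ∈ Ob(F)`; `A_D := Base(A) ∈ Ob(D)`. Write `A₀ ∈ Ob(D₀)` for the image of `A_D` in `D₀`. Then
> the natural action of `Aut_F(A)` on `O^▷(A), O^×(A)` factors through `Aut_{D₀}(A₀)`. If, moreover,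
> `Λ ∈ {ℤ, ℚ}`, then this factorization determines a faithful action of the image of `Aut_F(A)` in
> `Aut_{D₀}(A₀)` on `O^▷(A), O^×(A)`."

WHY THIS FILE (abc-iut cell, D-0079 sub-cell L-F [FrdI/II], table `plan/L1/LF-FRD.tsv` pack A, seat
abc-iut-L1-t2 gen 11; FACT rows F-0786 `ArchFrd.Thm36iv_faithful` (the second sentence AS PRINTED, flag
register L1 #6, STRUCK as a universal fact), F-0787 `ArchFrd.Thm36iv_faithful_of_isIsotropic` (repaired
reading (3)), F-0695 `ArchFrd.Thm36iv_faithful_istr` (repaired reading (1))).  The schema predicates of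
`ArchimedeanBasicProperties.lean` (seat abc-iut-L1-t9) bind the structure functor `F`, the base comparison
`G : D → ArchBase` and `Λ` freely.  The tree decides the printed sentence on the ABSOLUTE model `C₀` only
(`ArchFrd.C0.not_thm36iv_faithful_C0`, `ArchimedeanAutActionWitness.lean`); the repaired readings are PROVED at
`C`, `A` (`ArchimedeanAutActionReadings.lean`) and, as CONJUNCTS of the wrapper `ArchFrd.Thm36iv_readings_CA`, at
THE completions (`Thm36Sub.thm36iv_readings_CA_holds`).  This file records, with conclusion HEAD the row's
declaration at each genuine carrier of Example 3.3 over an ARBITRARY base `π : D → D₀`: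

* F-0786, `Λ = ℤ`, `F = C = C₀ ×_{D₀} D` and `F = A`: **FALSE** whenever the base `D` has an object `d` over
  `Spec ℂ` carrying an automorphism `σ` over complex conjugation (`not_thm36iv_faithful_C_of_conjLift`,
  `not_thm36iv_faithful_A_of_conjLift`): the object `(slit object of `C₀`, d)` — angular region with
  direction set `S¹ ∖ {−1}`, Ex. 3.3 (v) — is complex NON-isotropic, its automorphism `(conj, σ)` fixes
  `O^▷` and `O^×` pointwise (every base-identity linear endomorphism of the slit object has a positive REAL
  scalar, `C0.slitConj_conj_eq`) but is not the identity in `Aut_{D₀}(Spec ℂ)`; in particular at the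
  printed absolute base `D := D₀`, `π := 𝟭` (`not_thm36iv_faithful_C_id`, `not_thm36iv_faithful_A_id`).
  This is exactly referee ref-a's finding A8-F3 ("FALSE as printed at `Λ = ℤ` for complex non-isotropic
  `A`"), now at the genuine relative carriers and not only on `C₀`;
* F-0786, `Λ = ℚ`, `F = C^ℚ := C^pf` (THE perfection, `Thm36Sub.pfStr π hF`, under `hF :` "`C` is a
  Frobenioid", Ex. 3.3 (ii)): **TRUE** (`thm36iv_faithful_inst_pf`) — by Thm. 3.6 (i) "if `Λ ≥ ℚ`, then
  `(C^Λ)^istr = C^Λ`" (`Thm36Sub.istrAll_Q_holds`) every object is isotropic, so the printed sentence IS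
  reading (3), proved at `C^pf` (`Thm36Sub.thm36iv_readings_CA_holds`); generically
  `thm36iv_faithful_of_isOfIsotropicType` (printed sentence ⇐ reading (3) on a pre-Frobenioid of isotropic type);
* F-0786, `Λ = ℝ`: VACUOUS for every `F` (the sentence is stated for "`Λ ∈ {ℤ, ℚ}`"; `thm36iv_faithful_R`,
  `thm36iv_faithful_inst_rlf` at THE realification `Thm36Sub.rlfStr π`);
* F-0787 / F-0695 at `C^Λ` for EVERY `Λ` at THE completion data, and at `C^pf`, `C^rlf` separately, re-headed
  from the conjuncts of `Thm36Sub.thm36iv_readings_CA_holds` (`thm36iv_faithful_of_isIsotropic_inst_all/_pf/_rlf`,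
  `thm36iv_faithful_istr_inst_all/_pf/_rlf`), and in print generality under print's own standing hypotheses
  "`D` connected, totally epimorphic" (Ex. 3.3 (ii) p. 28; `ArchFrd.Ex33ii_isFrobenioid_holds`):
  `thm36iv_faithful_of_isIsotropic_CΛ`, `thm36iv_faithful_istr_CΛ`.

PROOF-ONLY: no `def`, no new `Prop`, no restated schema.  Honest framing: FACT rows are assumption LABELS on OUR
typed statements of the refereed [FrdII]; "proved"/"refuted" = OUR kernel check of OUR typed instance form (the
printed sentence stays labelled in `ArchimedeanBasicProperties.lean`; the repaired readings are the layer's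
readings of record); nothing here asserts abc proved or refuted; no side taken on [IUTchIII] Cor. 3.12; typed ≠ proved.
-/

noncomputable section

namespace Literature.AlgebraicGeometry.Frobenioids

open CategoryTheory

namespace ArchFrd

universe w v' u' v u

/-! ### Generic: the printed sentence on a pre-Frobenioid of isotropic type; the case `Λ = ℝ` -/

section Generic

variable {D : Type u} [Category.{v} D] {G : D ⥤ ArchBase} {Φ' : Dᵒᵖ ⥤ CommMonCat.{w}}
  {X : Type u'} [Category.{v'} X] {F : X ⥤ ElemFrobenioid Φ'} {Λ : MonoidType}

/-- **Printed sentence ⇐ reading (3) when every object is isotropic**: on a pre-Frobenioid of isotropic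
type ([FrdI] Def. 1.2 (v)) the second sentence of Thm. 3.6 (iv) as printed coincides with its repaired
reading (3) (faithfulness at isotropic objects). [cite: MochizukiFrdII2008, Thm 3.6 (iv) p.37] -/
theorem thm36iv_faithful_of_isOfIsotropicType (hI : PreFrobenioid.IsOfIsotropicType F)
    (h3 : Thm36iv_faithful_of_isIsotropic G F Λ) : Thm36iv_faithful G F Λ :=
  fun hΛ A α α' hend hunits => h3 hΛ A (hI A) α α' hend hunits

variable (G F) in
/-- **The printed sentence at `Λ = ℝ` is VACUOUS** for every pre-Frobenioid ("If, moreover, `Λ ∈ {ℤ, ℚ}` …",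
p. 37 l. 21: the typed guard `Λ ≠ ℝ` fails). [cite: MochizukiFrdII2008, Thm 3.6 (iv) p.37] -/
theorem thm36iv_faithful_R : Thm36iv_faithful G F MonoidType.R :=
  fun h => absurd rfl h

end Generic

variable {D : Type u} [Category.{v} D] (π : D ⥤ D0)

/-! ### `Λ = ℚ`, `Λ = ℝ`: THE perfection and THE realification of `C` -/

/-- **Thm. 3.6 (iv), second sentence AS PRINTED, at `C^ℚ := C^pf`** (THE perfection of `C = C₀ ×_{D₀} D`,
under `hF :` "`C` is a Frobenioid", Ex. 3.3 (ii)) — TRUE: every object of `C^pf` is isotropic (Thm. 3.6 (i),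
`Thm36Sub.istrAll_Q_holds`), so the sentence is reading (3), which holds at `C^pf`
(`Thm36Sub.thm36iv_readings_CA_holds`). FACT row F-0786. [cite: MochizukiFrdII2008, Thm 3.6 (iv) p.37] -/
theorem thm36iv_faithful_inst_pf (hF : PreFrobenioid.IsFrobenioid (C.toElem π)) :
    Thm36iv_faithful (baseRC π) (Thm36Sub.pfStr π hF) .Q :=
  thm36iv_faithful_of_isOfIsotropicType (Thm36Sub.istrAll_Q_holds π hF (by decide))
    ((Thm36Sub.thm36iv_readings_CA_holds π hF).1 .Q).1

/-- **Thm. 3.6 (iv), second sentence AS PRINTED, at `C^ℝ := C^rlf`** (THE realification) — VACUOUS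
(`Λ = ℝ`). FACT row F-0786. [cite: MochizukiFrdII2008, Thm 3.6 (iv) p.37] -/
theorem thm36iv_faithful_inst_rlf : Thm36iv_faithful (baseRC π) (Thm36Sub.rlfStr π) .R :=
  thm36iv_faithful_R _ _

/-! ### `Λ = ℤ`, `F = C` and `F = A`: FALSE over every base with an automorphism over complex conjugation -/

section ConjLift

variable {π}
variable {d : D} (e : D0.complex ≅ π.obj d) (σ : d ≅ d) (hσ : D0.conj ≫ e.hom = e.hom ≫ π.map σ.hom)
include hσ

/-- The inverse automorphism also lies over complex conjugation. [cite: MochizukiFrdII2008, Def 3.1 (i) p.23] -/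
private theorem conj_comp_eq_comp_map_inv : D0.conj ≫ e.hom = e.hom ≫ π.map σ.inv := by
  have h1 : e.hom = D0.conj ≫ e.hom ≫ π.map σ.inv := by
    rw [← Category.assoc, hσ, Category.assoc, ← CategoryTheory.Functor.map_comp, Iso.hom_inv_id,
      CategoryTheory.Functor.map_id, Category.comp_id]
  calc D0.conj ≫ e.hom = D0.conj ≫ (D0.conj ≫ e.hom ≫ π.map σ.inv) := by rw [← h1]
    _ = e.hom ≫ π.map σ.inv := by rw [← Category.assoc, D0.conj_comp_conj, Category.id_comp]

/-- The comparison `D₀ → ArchBase` does not kill `π(σ)`: it is complex conjugation transported along `e`.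
[cite: MochizukiFrdII2008, Def 3.1 (i) p.23] -/
private theorem toArchBase_map_map_ne_id :
    D0.toArchBase.map (π.map σ.hom) ≠ 𝟙 (D0.toArchBase.obj (π.obj d)) := by
  intro hm
  have hπσ : e.inv ≫ (D0.conj ≫ e.hom) = π.map σ.hom := (Iso.inv_comp_eq e).mpr hσ
  rw [← hπσ, CategoryTheory.Functor.map_comp, CategoryTheory.Functor.map_comp] at hm
  have h2 : D0.toArchBase.map e.inv ≫ D0.toArchBase.map D0.conj ≫ D0.toArchBase.map e.hom =
      D0.toArchBase.map e.inv ≫ 𝟙 _ ≫ D0.toArchBase.map e.hom := by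
    rw [hm, Category.id_comp, ← CategoryTheory.Functor.map_comp, Iso.inv_hom_id, CategoryTheory.Functor.map_id]
  exact D0.toArchBase_map_conj_ne_id ((cancel_mono _).mp ((cancel_epi _).mp h2))

variable (R : AngularRegion ℂ) (hR : R.dir = {z | z ≠ negOneUnit})
include hR

/-- The witness object of `C = C₀ ×_{D₀} D`: the slit object of `C₀` (complex, angular region with direction
set `S¹ ∖ {−1}`, Ex. 3.3 (v)) over `d`, identified along `e`, and its automorphism `(conj, σ)`; conjugating a
base-identity linear endomorphism by it does nothing. [cite: MochizukiFrdII2008, Thm 3.6 (iv) p.37] -/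
private theorem conj_action_trivial (f : (⟨C0.slitObj R, d, e⟩ : C π) ⟶ ⟨C0.slitObj R, d, e⟩)
    (hb : f.snd = 𝟙 d) (hd : C0.degFr f.fst = 1) :
    (⟨C0.slitConj R hR, σ.inv, by
        change D0.conj ≫ e.hom = e.hom ≫ π.map σ.inv
        exact conj_comp_eq_comp_map_inv e σ hσ⟩ : (⟨C0.slitObj R, d, e⟩ : C π) ⟶ ⟨C0.slitObj R, d, e⟩) ≫
      f ≫ ⟨C0.slitConj R hR, σ.hom, by
        change D0.conj ≫ e.hom = e.hom ≫ π.map σ.hom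
        exact hσ⟩ = f := by
  have hb0 : C0.Base f.fst = 𝟙 (C0.slitObj R).base := by
    have hw := f.w
    change C0.Base f.fst ≫ e.hom = e.hom ≫ π.map f.snd at hw
    rw [hb, CategoryTheory.Functor.map_id, Category.comp_id] at hw
    exact (cancel_mono e.hom).mp (hw.trans (Category.id_comp e.hom).symm)
  refine CFP.hom_ext ?_ ?_
  · change C0.slitConj R hR ≫ f.fst ≫ C0.slitConj R hR = f.fst
    exact C0.slitConj_conj_eq R hR f.fst hb0 hd
  · change σ.inv ≫ f.snd ≫ σ.hom = f.snd
    rw [hb, Category.id_comp, Iso.inv_hom_id]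

/-- **Thm. 3.6 (iv), second sentence AS PRINTED, is FALSE at `C = C^ℤ = C₀ ×_{D₀} D`** over every base
`π : D → D₀` admitting an object `d` over `Spec ℂ` (identification `e`) with an automorphism `σ` over complex
conjugation: the automorphism `(conj, σ)` of the (complex, non-isotropic) slit object over `d` and the identity
act identically on `O^▷`, `O^×` but have distinct images in `Aut_{D₀}(Spec ℂ)`. FACT row F-0786 (referee
finding A8-F3 at the genuine relative carrier). [cite: MochizukiFrdII2008, Thm 3.6 (iv) p.37] -/
theorem not_thm36iv_faithful_C_of_conjLift_region :
    ¬ Thm36iv_faithful (baseRC π) (C.toElem π) MonoidType.Z := by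
  intro h
  let X : C π := ⟨C0.slitObj R, d, e⟩
  let α : X ≅ X :=
    { hom := ⟨C0.slitConj R hR, σ.hom, by
        change D0.conj ≫ e.hom = e.hom ≫ π.map σ.hom
        exact hσ⟩
      inv := ⟨C0.slitConj R hR, σ.inv, by
        change D0.conj ≫ e.hom = e.hom ≫ π.map σ.inv
        exact conj_comp_eq_comp_map_inv e σ hσ⟩
      hom_inv_id := CFP.hom_ext (C0.slitConj_comp_slitConj R hR) σ.hom_inv_id
      inv_hom_id := CFP.hom_ext (C0.slitConj_comp_slitConj R hR) σ.inv_hom_id }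
  have key := h (by decide) X α (Iso.refl X)
    (fun f hf => by
      rw [Iso.refl_inv, Iso.refl_hom, Category.id_comp, Category.comp_id]
      exact conj_action_trivial e σ hσ R hR f hf.1 hf.2)
    (fun u hu => by
      ext : 1
      rw [Iso.trans_hom, Iso.trans_hom, Iso.symm_hom, Iso.trans_hom, Iso.trans_hom, Iso.symm_hom,
        Iso.refl_inv, Iso.refl_hom, Category.id_comp, Category.comp_id]
      exact conj_action_trivial e σ hσ R hR u.hom hu.1 hu.2)
  have hhom := congrArg Iso.hom key
  rw [Functor.mapIso_hom, Functor.mapIso_hom, Iso.refl_hom, CategoryTheory.Functor.map_id] at hhom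
  change D0.toArchBase.map (π.map σ.hom) = 𝟙 (D0.toArchBase.obj (π.obj d)) at hhom
  exact toArchBase_map_map_ne_id e σ hσ hhom

/-- **The same at the angular Frobenioid `F = A ⊆ C`** (the slit object lies in `A`; automorphisms of `C`
are isometries; `O^▷`, `O^×` of `A` at it consist of the same arrows). FACT row F-0786.
[cite: MochizukiFrdII2008, Thm 3.6 (iv) p.37] -/
theorem not_thm36iv_faithful_A_of_conjLift_region :
    ¬ Thm36iv_faithful (baseRC π) (A.toElem π) MonoidType.Z := by
  intro h
  let X : C π := ⟨C0.slitObj R, d, e⟩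
  let α : X ≅ X :=
    { hom := ⟨C0.slitConj R hR, σ.hom, by
        change D0.conj ≫ e.hom = e.hom ≫ π.map σ.hom
        exact hσ⟩
      inv := ⟨C0.slitConj R hR, σ.inv, by
        change D0.conj ≫ e.hom = e.hom ≫ π.map σ.inv
        exact conj_comp_eq_comp_map_inv e σ hσ⟩
      hom_inv_id := CFP.hom_ext (C0.slitConj_comp_slitConj R hR) σ.hom_inv_id
      inv_hom_id := CFP.hom_ext (C0.slitConj_comp_slitConj R hR) σ.inv_hom_id }
  haveI : IsIso α.hom := ⟨⟨α.inv, α.hom_inv_id, α.inv_hom_id⟩⟩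
  haveI : IsIso α.inv := ⟨⟨α.hom, α.inv_hom_id, α.hom_inv_id⟩⟩
  have hhom : PreFrobenioid.isometricMorphisms (C.toElem π) α.hom := by
    rw [PreFrobenioid.isometricMorphisms_iff]
    have := C.isIsometry_inv π α.inv
    rwa [IsIso.Iso.inv_inv] at this
  have hinv : PreFrobenioid.isometricMorphisms (C.toElem π) α.inv := by
    rw [PreFrobenioid.isometricMorphisms_iff]
    have := C.isIsometry_inv π α.hom
    rwa [IsIso.Iso.inv_hom] at this
  let XA : A π := ⟨X⟩
  let αA : XA ≅ XA :=
    { hom := ⟨α.hom, hhom⟩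
      inv := ⟨α.inv, hinv⟩
      hom_inv_id := WideSubcategory.hom_ext _ α.hom_inv_id
      inv_hom_id := WideSubcategory.hom_ext _ α.inv_hom_id }
  have key := h (by decide) XA αA (Iso.refl XA)
    (fun f hf => by
      rw [Iso.refl_inv, Iso.refl_hom, Category.id_comp, Category.comp_id]
      refine WideSubcategory.hom_ext _ ?_
      change α.inv ≫ f.hom ≫ α.hom = f.hom
      exact conj_action_trivial e σ hσ R hR f.hom hf.1 hf.2)
    (fun u hu => by
      ext : 1
      rw [Iso.trans_hom, Iso.trans_hom, Iso.symm_hom, Iso.trans_hom, Iso.trans_hom, Iso.symm_hom,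
        Iso.refl_inv, Iso.refl_hom, Category.id_comp, Category.comp_id]
      refine WideSubcategory.hom_ext _ ?_
      change α.inv ≫ u.hom.hom ≫ α.hom = u.hom.hom
      exact conj_action_trivial e σ hσ R hR u.hom.hom hu.1 hu.2)
  have hh := congrArg Iso.hom key
  rw [Functor.mapIso_hom, Functor.mapIso_hom, Iso.refl_hom, CategoryTheory.Functor.map_id] at hh
  change D0.toArchBase.map (π.map σ.hom) = 𝟙 (D0.toArchBase.obj (π.obj d)) at hh
  exact toArchBase_map_map_ne_id e σ hσ hh

end ConjLift

/-- **Thm. 3.6 (iv), second sentence AS PRINTED, is FALSE at `C = C^ℤ`** over every base `π : D → D₀` with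
an object over `Spec ℂ` carrying an automorphism over complex conjugation (UNCONDITIONAL: the slit region
`ArchFrd.slitRegion 1` of seat abc-iut-L1-t6 supplies the witness region). FACT row F-0786.
[cite: MochizukiFrdII2008, Thm 3.6 (iv) p.37] -/
theorem not_thm36iv_faithful_C_of_conjLift {d : D} (e : D0.complex ≅ π.obj d) (σ : d ≅ d)
    (hσ : D0.conj ≫ e.hom = e.hom ≫ π.map σ.hom) :
    ¬ Thm36iv_faithful (baseRC π) (C.toElem π) MonoidType.Z :=
  not_thm36iv_faithful_C_of_conjLift_region e σ hσ (slitRegion 1) (slitRegion_dir 1)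

/-- **The same at `F = A`** (UNCONDITIONAL). FACT row F-0786. [cite: MochizukiFrdII2008, Thm 3.6 (iv) p.37] -/
theorem not_thm36iv_faithful_A_of_conjLift {d : D} (e : D0.complex ≅ π.obj d) (σ : d ≅ d)
    (hσ : D0.conj ≫ e.hom = e.hom ≫ π.map σ.hom) :
    ¬ Thm36iv_faithful (baseRC π) (A.toElem π) MonoidType.Z :=
  not_thm36iv_faithful_A_of_conjLift_region e σ hσ (slitRegion 1) (slitRegion_dir 1)

/-- **At the printed absolute base `D := D₀`, `π := 𝟭 D₀`** (Ex. 3.3 (i): "`D₀` … is a connected, totally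
epimorphic category"): the second sentence of Thm. 3.6 (iv) AS PRINTED is FALSE for `C = C₀ ×_{D₀} D₀`
(`Λ = ℤ`) — complex conjugation itself is the required automorphism. FACT row F-0786.
[cite: MochizukiFrdII2008, Thm 3.6 (iv) p.37] -/
theorem not_thm36iv_faithful_C_id :
    ¬ Thm36iv_faithful (baseRC (𝟭 D0)) (C.toElem (𝟭 D0)) MonoidType.Z :=
  not_thm36iv_faithful_C_of_conjLift (𝟭 D0) (d := D0.complex) (Iso.refl _)
    ⟨D0.conj, D0.conj, D0.conj_comp_conj, D0.conj_comp_conj⟩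
    (by change D0.conj ≫ 𝟙 D0.complex = 𝟙 D0.complex ≫ D0.conj; rw [Category.comp_id, Category.id_comp])

/-- **At the printed absolute base, `F = A`**: FALSE likewise. FACT row F-0786. [cite: MochizukiFrdII2008, Thm 3.6 (iv) p.37] -/
theorem not_thm36iv_faithful_A_id :
    ¬ Thm36iv_faithful (baseRC (𝟭 D0)) (A.toElem (𝟭 D0)) MonoidType.Z :=
  not_thm36iv_faithful_A_of_conjLift (𝟭 D0) (d := D0.complex) (Iso.refl _)
    ⟨D0.conj, D0.conj, D0.conj_comp_conj, D0.conj_comp_conj⟩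
    (by change D0.conj ≫ 𝟙 D0.complex = 𝟙 D0.complex ≫ D0.conj; rw [Category.comp_id, Category.id_comp])

/-! ### The repaired readings (3) and (1) at `C^Λ`, head-exact (F-0787, F-0695) -/

/-- **Reading (3) at `C^ℚ := C^pf`** (THE perfection; F-0787) — re-headed from the `Λ = ℚ` conjunct of
`Thm36Sub.thm36iv_readings_CA_holds` (seat abc-iut-w5-d237's `Thm36SubReadingsQ.lean`).
[cite: MochizukiFrdII2008, Thm 3.6 (iv) p.37] -/
theorem thm36iv_faithful_of_isIsotropic_inst_pf (hF : PreFrobenioid.IsFrobenioid (C.toElem π)) :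
    Thm36iv_faithful_of_isIsotropic (baseRC π) (Thm36Sub.pfStr π hF) .Q :=
  ((Thm36Sub.thm36iv_readings_CA_holds π hF).1 .Q).1

/-- **Reading (1) at `C^ℚ := C^pf`** (F-0695). [cite: MochizukiFrdII2008, Thm 3.6 (iv) p.37] -/
theorem thm36iv_faithful_istr_inst_pf (hF : PreFrobenioid.IsFrobenioid (C.toElem π)) :
    Thm36iv_faithful_istr (baseRC π) (Thm36Sub.pfStr π hF) .Q :=
  ((Thm36Sub.thm36iv_readings_CA_holds π hF).1 .Q).2

/-- **Reading (3) at `C^ℝ := C^rlf`** (THE realification; F-0787) — vacuous (`Λ = ℝ`).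
[cite: MochizukiFrdII2008, Thm 3.6 (iv) p.37] -/
theorem thm36iv_faithful_of_isIsotropic_inst_rlf :
    Thm36iv_faithful_of_isIsotropic (baseRC π) (Thm36Sub.rlfStr π) .R :=
  fun h => absurd rfl h

/-- **Reading (1) at `C^ℝ := C^rlf`** (F-0695) — vacuous (`Λ = ℝ`). [cite: MochizukiFrdII2008, Thm 3.6 (iv) p.37] -/
theorem thm36iv_faithful_istr_inst_rlf : Thm36iv_faithful_istr (baseRC π) (Thm36Sub.rlfStr π) .R :=
  fun h => absurd rfl h

/-- **Reading (3) at `C^Λ` for EVERY `Λ`** at THE completion data (F-0787; the `Λ`-th conjunct of abc-iut-L1-t9's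
`Thm36iv_readings_CA`, closed by `Thm36Sub.thm36iv_readings_CA_holds`). [cite: MochizukiFrdII2008, Thm 3.6 (iv) p.37] -/
theorem thm36iv_faithful_of_isIsotropic_inst_all (hF : PreFrobenioid.IsFrobenioid (C.toElem π))
    (Λ : MonoidType) :
    Thm36iv_faithful_of_isIsotropic (baseRC π)
      (archFrobenioid π (Thm36Sub.pfCompletion π hF) (Thm36Sub.rlfCompletion π) Λ).str Λ :=
  ((Thm36Sub.thm36iv_readings_CA_holds π hF).1 Λ).1

/-- **Reading (1) at `C^Λ` for EVERY `Λ`** at THE completion data (F-0695). [cite: MochizukiFrdII2008, Thm 3.6 (iv) p.37] -/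
theorem thm36iv_faithful_istr_inst_all (hF : PreFrobenioid.IsFrobenioid (C.toElem π)) (Λ : MonoidType) :
    Thm36iv_faithful_istr (baseRC π)
      (archFrobenioid π (Thm36Sub.pfCompletion π hF) (Thm36Sub.rlfCompletion π) Λ).str Λ :=
  ((Thm36Sub.thm36iv_readings_CA_holds π hF).1 Λ).2

/-- **Reading (3) at `C^Λ`, every `Λ`, in print generality** under print's standing hypotheses "`D` connected,
totally epimorphic" (Ex. 3.3 (ii) p. 28, which make `C` a Frobenioid: `Ex33ii_isFrobenioid_holds`).
[cite: MochizukiFrdII2008, Thm 3.6 (iv) p.37] -/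
theorem thm36iv_faithful_of_isIsotropic_CΛ (hD : IsGraphConnected D) (hTE : IsTotallyEpimorphic D)
    (Λ : MonoidType) :
    Thm36iv_faithful_of_isIsotropic (baseRC π)
      (archFrobenioid π (Thm36Sub.pfCompletion π (Ex33ii_isFrobenioid_holds π hD hTE))
        (Thm36Sub.rlfCompletion π) Λ).str Λ :=
  thm36iv_faithful_of_isIsotropic_inst_all π _ Λ

/-- **Reading (1) at `C^Λ`, every `Λ`, in print generality** ("`D` connected, totally epimorphic").
[cite: MochizukiFrdII2008, Thm 3.6 (iv) p.37] -/
theorem thm36iv_faithful_istr_CΛ (hD : IsGraphConnected D) (hTE : IsTotallyEpimorphic D) (Λ : MonoidType) :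
    Thm36iv_faithful_istr (baseRC π)
      (archFrobenioid π (Thm36Sub.pfCompletion π (Ex33ii_isFrobenioid_holds π hD hTE))
        (Thm36Sub.rlfCompletion π) Λ).str Λ :=
  thm36iv_faithful_istr_inst_all π _ Λ

/-- **The printed sentence at `C^ℚ` in print generality** ("`D` connected, totally epimorphic"; F-0786, TRUE at
`Λ = ℚ`). [cite: MochizukiFrdII2008, Thm 3.6 (iv) p.37] -/
theorem thm36iv_faithful_CQ (hD : IsGraphConnected D) (hTE : IsTotallyEpimorphic D) :
    Thm36iv_faithful (baseRC π)
      (archFrobenioid π (Thm36Sub.pfCompletion π (Ex33ii_isFrobenioid_holds π hD hTE))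
        (Thm36Sub.rlfCompletion π) .Q).str .Q :=
  thm36iv_faithful_inst_pf π _

end ArchFrd

end Literature.AlgebraicGeometry.Frobenioids

end
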